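import Summits.ValiantsHypothesis.ValiantsHypothesis.Theorems.KPlusLogSqLawTropicalBExchangeSquare
import Summits.ValiantsHypothesis.ValiantsHypothesis.Theorems.LacunarySymmetroidMatrixDescartesCensusTropicalKLawSlopes
import Summits.ValiantsHypothesis.ValiantsHypothesis.Theorems.LacunarySymmetroidMatrixDescartesCensusTropicalKLawStatic

/-!
# `TropicalB` (stmt-ValiantsHypothesis-19771) — DIAGONAL BRACKETING and the 3 × 3 PARITY-CLASS LAW: where the HIDDEN corners of an
# exchange square / the other parity class of a `3 × 3` block must lie when one side is dominant

Helper file for the crux `Theses.KPlusLogSqLaw.TropicalB` (`--supports stmt-ValiantsHypothesis-19771 --as helper`), cell `pub-symmetroid`,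
seat val-sym-trop-p4 (g7).  HONEST FRAMING: two structure lemmas about the dominant terms of an ARBITRARY tropical design `(d, v, ε)` (any
`m`, `K`) in the tree's vocabulary (`IsDominant`, `tropWeight`, `termSign`, `TropicalCensus.slope`); they are the two geometric ingredients —
beyond the tree's EXCHANGE-SQUARE LAW `ExchangeSquare.not_dominant_split_square` (p493290) — of this seat's located result «the static
`4 × 4` cell is exactly `15`» (memo `HOME/val-sym-trop-p4/g7/STATIC4-g7.md`; kernel today `15 ≤ · ≤ 17`, p515185 / p520468).  Nothing here bears on
`TropicalB` in its window, `WeakLifting`, `MatrixDescartes` (stmt-ValiantsHypothesis-18050) or VP ≠ VNP.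

* `slope_bracket` — **DIAGONAL BRACKETING.**  Four terms in a weight parallelogram `w(p₁₁) + w(p₂₂) = w(p₁₂) + w(p₂₁)` (all `θ`) whose
  DIAGONAL `p₁₁, p₂₂` is dominant at `θ₁ < θ₄`, with the other two corners PRESENT (and different from the diagonal): then the slopes of the
  hidden corners lie STRICTLY BETWEEN: `slope p₁₁ < slope p₁₂ < slope p₂₂` and `slope p₁₁ < slope p₂₁ < slope p₂₂`.  Proof: the affine
  function `w(p₁₂) − w(p₁₁)` is `< 0` at `θ₁` (dominance of `p₁₁`) and `> 0` at `θ₄` (there `w(p₁₁) = w(p₁₂) + w(p₂₁) − w(p₂₂) < w(p₁₂)` by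
  dominance of `p₂₂` over `p₂₁`), so its slope is positive; four times.  With three dominant corners this is the «middle rule» (the doubly
  adjacent corner is the slope-middle); the exchange-square law is the case of four.
* `slope_bracket_split` — **SPLIT FORM, every design.**  Gluing two `S`-halves with two `Sᶜ`-halves in all four ways (the pattern of
  `not_dominant_split_square`): if the two «pure» gluings `L ∪ Q`, `L' ∪ Q'` are dominant at `θ₁ < θ₄` then the mixed gluings are automatically
  present and their slopes are strictly between.
* `parity_class_not_majorized` — **`3 × 3` PARITY-CLASS LAW.**  Six terms with `w(e₁) + w(e₂) + w(e₃) = w(o) + w(o') + w(o'')` (all `θ`; e.g. the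
  even and the odd permutations inside a `3 × 3` block of a static design, both Latin squares), `e₁, e₂, e₃` dominant at `θ₁ < θ₂ < θ₃`, the
  `o`'s present, `o ≠ e₁`, `o'' ≠ e₂`, `o' ≠ e₃`: then NOT (`slope o ≤ slope e₁` and `slope e₃ ≤ slope o'`) — the other class does not weakly
  majorise the dominant class in slope.  Proof: `w(e₁) − w(o)` has slope `≥ 0` and is positive at `θ₁`, hence at `θ₂`; `w(e₃) − w(o')` has slope
  `≤ 0` and is positive at `θ₃`, hence at `θ₂`; `w(e₂) > w(o'')` at `θ₂`; the sum contradicts the identity at `θ₂`.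
[this seat; elementary]
-/

set_option linter.dupNamespace false
set_option autoImplicit false

namespace Summit.ValiantsHypothesis.ValiantsHypothesis.Theorems.KPlusLogSqLaw.Bracketing

open Summit.ValiantsHypothesis.ValiantsHypothesis.Theorems.MatrixDescartes.Negative
open Summit.ValiantsHypothesis.ValiantsHypothesis.Theorems.LacunarySymmetroidMatrixDescartes
open Summit.ValiantsHypothesis.ValiantsHypothesis.Theorems.LacunarySymmetroidMatrixDescartes.TropicalCensus
open Finset

variable {m K : ℕ} (d : Fin K → ℕ) (v ε : Fin m → Fin m → Fin K → ℤ)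

/-- an affine function of an integer variable that is negative at `θ₁` and positive at `θ₄ > θ₁` has positive slope. -/
theorem slope_pos_of_neg_of_pos {θ₁ θ₄ a c : ℤ} (h14 : θ₁ < θ₄) (h1 : θ₁ * a - c < 0) (h4 : 0 < θ₄ * a - c) : 0 < a := by
  by_contra ha
  push Not at ha
  have : (θ₄ - θ₁) * a ≤ 0 := mul_nonpos_of_nonneg_of_nonpos (by linarith) ha
  nlinarith

/-- **DIAGONAL BRACKETING**: if a diagonal `p₁₁, p₂₂` of a weight parallelogram is dominant at `θ₁ < θ₄` and the other two corners are
present, then their slopes lie strictly between the slopes of the diagonal. -/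
theorem slope_bracket {p₁₁ p₁₂ p₂₁ p₂₂ : Equiv.Perm (Fin m) × (Fin m → Fin K)} {θ₁ θ₄ : ℤ} (h14 : θ₁ < θ₄)
    (hpar : ∀ θ : ℤ, tropWeight d v θ p₁₁ + tropWeight d v θ p₂₂ = tropWeight d v θ p₁₂ + tropWeight d v θ p₂₁)
    (h₂₁ : p₁₂ ≠ p₁₁) (h₂₄ : p₁₂ ≠ p₂₂) (h₃₁ : p₂₁ ≠ p₁₁) (h₃₄ : p₂₁ ≠ p₂₂)
    (hp₂ : termSign ε p₁₂ ≠ 0) (hp₃ : termSign ε p₂₁ ≠ 0)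
    (d₁ : IsDominant d v ε θ₁ p₁₁) (d₄ : IsDominant d v ε θ₄ p₂₂) :
    TropicalCensus.slope d p₁₁ < TropicalCensus.slope d p₁₂ ∧ TropicalCensus.slope d p₁₂ < TropicalCensus.slope d p₂₂ ∧
      TropicalCensus.slope d p₁₁ < TropicalCensus.slope d p₂₁ ∧ TropicalCensus.slope d p₂₁ < TropicalCensus.slope d p₂₂ := by
  have c12 := d₁.2 p₁₂ h₂₁ hp₂
  have c13 := d₁.2 p₂₁ h₃₁ hp₃
  have c42 := d₄.2 p₁₂ h₂₄ hp₂
  have c43 := d₄.2 p₂₁ h₃₄ hp₃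
  have q1 := hpar θ₁
  have q4 := hpar θ₄
  simp only [tropWeight] at c12 c13 c42 c43 q1 q4
  unfold TropicalCensus.slope
  set S₁₁ := ∑ i, (d (p₁₁.2 i) : ℤ)
  set S₁₂ := ∑ i, (d (p₁₂.2 i) : ℤ)
  set S₂₁ := ∑ i, (d (p₂₁.2 i) : ℤ)
  set S₂₂ := ∑ i, (d (p₂₂.2 i) : ℤ)
  set V₁₁ := ∑ i, v (p₁₁.1 i) i (p₁₁.2 i)
  set V₁₂ := ∑ i, v (p₁₂.1 i) i (p₁₂.2 i)
  set V₂₁ := ∑ i, v (p₂₁.1 i) i (p₂₁.2 i)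
  set V₂₂ := ∑ i, v (p₂₂.1 i) i (p₂₂.2 i)
  refine ⟨?_, ?_, ?_, ?_⟩
  · -- `w(p₁₂) − w(p₁₁)`: negative at `θ₁`, positive at `θ₄`
    refine Int.lt_of_sub_pos (slope_pos_of_neg_of_pos (a := S₁₂ - S₁₁) (c := V₁₂ - V₁₁) h14 ?_ ?_) <;> nlinarith
  · -- `w(p₂₂) − w(p₁₂)`
    refine Int.lt_of_sub_pos (slope_pos_of_neg_of_pos (a := S₂₂ - S₁₂) (c := V₂₂ - V₁₂) h14 ?_ ?_) <;> nlinarith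
  · refine Int.lt_of_sub_pos (slope_pos_of_neg_of_pos (a := S₂₁ - S₁₁) (c := V₂₁ - V₁₁) h14 ?_ ?_) <;> nlinarith
  · refine Int.lt_of_sub_pos (slope_pos_of_neg_of_pos (a := S₂₂ - S₂₁) (c := V₂₂ - V₂₁) h14 ?_ ?_) <;> nlinarith

/-- a term all of whose entries are present is present. -/
theorem termSign_ne_zero_of_present (q : Equiv.Perm (Fin m) × (Fin m → Fin K)) (h : ∀ i, ε (q.1 i) i (q.2 i) ≠ 0) :
    termSign ε q ≠ 0 := by
  unfold termSign
  refine mul_ne_zero ?_ (Finset.prod_ne_zero_iff.2 fun i _ => h i)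
  exact Units.ne_zero _

/-- **SPLIT FORM (every design).**  For a column set `S` and terms `p₁₁ = L ∪ Q`, `p₁₂ = L ∪ Q'`, `p₂₁ = L' ∪ Q`, `p₂₂ = L' ∪ Q'` (agreement of
row and class on `S`, resp. off `S`) with `L ≠ L'` and `Q ≠ Q'`: if the diagonal `p₁₁`, `p₂₂` is dominant at `θ₁ < θ₄`, the mixed corners
`p₁₂`, `p₂₁` are present and their slopes lie strictly between `slope p₁₁ < · < slope p₂₂`. -/
theorem slope_bracket_split (S : Finset (Fin m)) {p₁₁ p₁₂ p₂₁ p₂₂ : Equiv.Perm (Fin m) × (Fin m → Fin K)} {θ₁ θ₄ : ℤ}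
    (h14 : θ₁ < θ₄)
    (hL : ∀ i ∈ S, p₁₁.1 i = p₁₂.1 i ∧ p₁₁.2 i = p₁₂.2 i) (hL' : ∀ i ∈ S, p₂₁.1 i = p₂₂.1 i ∧ p₂₁.2 i = p₂₂.2 i)
    (hR : ∀ i, i ∉ S → (p₁₁.1 i = p₂₁.1 i ∧ p₁₁.2 i = p₂₁.2 i))
    (hR' : ∀ i, i ∉ S → (p₁₂.1 i = p₂₂.1 i ∧ p₁₂.2 i = p₂₂.2 i))
    (h₁₂ : p₁₁ ≠ p₁₂) (h₁₃ : p₁₁ ≠ p₂₁)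
    (d₁ : IsDominant d v ε θ₁ p₁₁) (d₄ : IsDominant d v ε θ₄ p₂₂) :
    TropicalCensus.slope d p₁₁ < TropicalCensus.slope d p₁₂ ∧ TropicalCensus.slope d p₁₂ < TropicalCensus.slope d p₂₂ ∧
      TropicalCensus.slope d p₁₁ < TropicalCensus.slope d p₂₁ ∧ TropicalCensus.slope d p₂₁ < TropicalCensus.slope d p₂₂ := by
  classical
  -- presence of the mixed corners: their entries are entries of `p₁₁` or of `p₂₂`
  have e₁ := fun i => TropicalCensus.present_of_termSign_ne_zero ε p₁₁ d₁.1 i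
  have e₄ := fun i => TropicalCensus.present_of_termSign_ne_zero ε p₂₂ d₄.1 i
  have hp₂ : termSign ε p₁₂ ≠ 0 := by
    refine termSign_ne_zero_of_present ε p₁₂ fun i => ?_
    by_cases hi : i ∈ S
    · rw [← (hL i hi).1, ← (hL i hi).2]; exact e₁ i
    · rw [(hR' i hi).1, (hR' i hi).2]; exact e₄ i
  have hp₃ : termSign ε p₂₁ ≠ 0 := by
    refine termSign_ne_zero_of_present ε p₂₁ fun i => ?_
    by_cases hi : i ∈ S
    · rw [(hL' i hi).1, (hL' i hi).2]; exact e₄ i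
    · rw [← (hR i hi).1, ← (hR i hi).2]; exact e₁ i
  -- the remaining inequalities between corners, as in `not_dominant_split_square`
  have h₄₂ : p₂₂ ≠ p₁₂ := by
    intro he
    apply h₁₃
    refine ExchangeSquare.term_eq_of_agree fun i => ?_
    by_cases hi : i ∈ S
    · have a := hL i hi; have b := hL' i hi
      rw [he] at b
      exact ⟨a.1.trans b.1.symm, a.2.trans b.2.symm⟩
    · exact hR i hi
  have h₄₃ : p₂₂ ≠ p₂₁ := by
    intro he
    apply h₁₂
    refine ExchangeSquare.term_eq_of_agree fun i => ?_
    by_cases hi : i ∈ S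
    · exact hL i hi
    · have a := hR i hi; have b := hR' i hi
      rw [he] at b
      exact ⟨a.1.trans b.1.symm, a.2.trans b.2.symm⟩
  refine slope_bracket d v ε h14 (fun θ => ?_) h₁₂.symm h₄₂.symm h₁₃.symm h₄₃.symm hp₂ hp₃ d₁ d₄
  have hs := ExchangeSquare.sum_square_of_halves S (fun _ _ l => (d l : ℤ)) hL hL' hR hR'
  have hv := ExchangeSquare.sum_square_of_halves S v hL hL' hR hR'
  simp only [tropWeight]
  linear_combination θ * hs - hv

/-- **THE `3 × 3` PARITY-CLASS LAW.**  If `w(e₁) + w(e₂) + w(e₃) = w(o) + w(o') + w(o'')` identically, `e₁, e₂, e₃` are dominant at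
`θ₁ < θ₂ < θ₃`, and `o, o', o''` are present with `o ≠ e₁`, `o' ≠ e₃`, `o'' ≠ e₂`, then it is impossible that `slope o ≤ slope e₁` and
`slope e₃ ≤ slope o'`: the hidden class does not weakly majorise the dominant class in slope. -/
theorem parity_class_not_majorized {e₁ e₂ e₃ o o' o'' : Equiv.Perm (Fin m) × (Fin m → Fin K)} {θ₁ θ₂ θ₃ : ℤ}
    (h12 : θ₁ < θ₂) (h23 : θ₂ < θ₃)
    (hsum : ∀ θ : ℤ, tropWeight d v θ e₁ + tropWeight d v θ e₂ + tropWeight d v θ e₃ =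
      tropWeight d v θ o + tropWeight d v θ o' + tropWeight d v θ o'')
    (ho : termSign ε o ≠ 0) (ho' : termSign ε o' ≠ 0) (ho'' : termSign ε o'' ≠ 0)
    (hne₁ : o ≠ e₁) (hne₃ : o' ≠ e₃) (hne₂ : o'' ≠ e₂)
    (d₁ : IsDominant d v ε θ₁ e₁) (d₂ : IsDominant d v ε θ₂ e₂) (d₃ : IsDominant d v ε θ₃ e₃)
    (hlo : TropicalCensus.slope d o ≤ TropicalCensus.slope d e₁) (hhi : TropicalCensus.slope d e₃ ≤ TropicalCensus.slope d o') :
    False := by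
  have c1 := d₁.2 o hne₁ ho
  have c2 := d₂.2 o'' hne₂ ho''
  have c3 := d₃.2 o' hne₃ ho'
  have q2 := hsum θ₂
  unfold TropicalCensus.slope at hlo hhi
  simp only [tropWeight] at c1 c2 c3 q2
  set S₁ := ∑ i, (d (e₁.2 i) : ℤ)
  set S₂ := ∑ i, (d (e₂.2 i) : ℤ)
  set S₃ := ∑ i, (d (e₃.2 i) : ℤ)
  set T₁ := ∑ i, (d (o.2 i) : ℤ)
  set T₂ := ∑ i, (d (o'.2 i) : ℤ)
  set T₃ := ∑ i, (d (o''.2 i) : ℤ)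
  set V₁ := ∑ i, v (e₁.1 i) i (e₁.2 i)
  set V₂ := ∑ i, v (e₂.1 i) i (e₂.2 i)
  set V₃ := ∑ i, v (e₃.1 i) i (e₃.2 i)
  set W₁ := ∑ i, v (o.1 i) i (o.2 i)
  set W₂ := ∑ i, v (o'.1 i) i (o'.2 i)
  set W₃ := ∑ i, v (o''.1 i) i (o''.2 i)
  have k1 : 0 ≤ (θ₂ - θ₁) * (S₁ - T₁) := mul_nonneg (by linarith) (by linarith)
  have k3 : 0 ≤ (θ₃ - θ₂) * (T₂ - S₃) := mul_nonneg (by linarith) (by linarith)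
  nlinarith [k1, k3, c1, c2, c3, q2]

end Summit.ValiantsHypothesis.ValiantsHypothesis.Theorems.KPlusLogSqLaw.Bracketing
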